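import Mathlib
import HarnessLib
import Summits.NavierStokesRegularity.NavierStokesRegularity.Theorems.TaylorModelRungThreeCertificateReadoutVLandD

/-!
# Crux K1b-DR (stmt-NavierStokesRegularity-23954), line `taylor-model` — v3 read-outs, K-SIDE part 3N: FULL-PRECISION
# RECIPROCALS for the landing family (engine-1 g70; repair of a numerical defect of parts 3a/3b, every landed name kept)

Why. `IntervalD.invPos prec I = [⌊2^prec / hi.m⌋·2^(−prec−hi.e), ⌈2^prec / lo.m⌉·2^(−prec−lo.e)]` (part 3a) is SOUND but carries only
`⌊log₂(2^prec / m)⌋ + 1` significant bits: its numerator is fixed at `2^prec` whatever the mantissa length of the argument.  In the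
read-out layer every argument is a `roundOut prec` result, i.e. a mantissa of `prec` (= 64) bits, so the quotient is `1` or `2` and the
reciprocal box is `[1, 2]·2^(−prec−e)` — a factor-2-wide enclosure.  It enters the landing normalisation `1/|y_{i₀1}|` (`landBox`), the
landing Jacobian (`dlBox`: `1/|y|`, `1/|y|²`) and the section projector (`psBox`: `1/⟨σ, F⟩`).  Measured consequence (engine-1 g70,
2026-08-29, cert-1 v5 data): the base-landing defect `cenC_l = mag(W_l·landBox(Z⁰c) − ctr_l)` of (R9)/(R9p) equals
`(t/2)·Σ_c |w_lc|·|land(y_c)_c|` with `t = |y_{i₀1}(τc)|/2^⌈log₂|y_{i₀1}|⌉` to six digits on every inspected face (e.g. stage 20, face 277: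
predicted 0.70995, replayed 0.709953), while the true defect `|w_l·land(y_c) − ctr_l|` is `≲ 10⁻¹²` against a slack of `2·10⁻⁹`.

Repair (append-only; nothing landed is touched):
* `IntervalD.invPosN prec I` — the same two quotients with the numerator scaled to the argument's mantissa length,
  `lo := (invPos (prec + bits hi.m) I).lo`, `hi := (invPos (prec + bits lo.m) I).hi`, `bits m := log₂|m| + 1`; soundness
  `mem_invPosN` is `mem_invPos` at the two precisions (≥ `prec + 1` significant bits);
* `CertTables.landBoxN` / `mem_landF_landBoxN`, `dlBoxN` / `memMat_dlBoxN`, `psBoxN` / `memMat_psBoxN`, `testR11N` / `testR11N_sound`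
  — the part-3a/3b kernels VERBATIM with `invPosN` for `invPos` (the structural tests `landOK`, `psOK` are unchanged and reused).

The windowed / Poincaré-corrected steps re-pointed at these kernels are parts 4-WN / 4-WPN (separate modules).

HONEST FRAMING: kernel bookkeeping for the MODEL certificate №23954 (rung TL-M3); nothing here is a statement about the
Navier–Stokes equations.
-/

-- the sub-problem namespace repeats the summit name by design (D-0017)
set_option linter.dupNamespace false

namespace Summit.NavierStokesRegularity.NavierStokesRegularity.Theorems.TaylorModelCert

open scoped BigOperators
open Set
open Literature.Analysis.FluidPDE.TaoCascade Literature.Analysis.FluidPDE.TaoCascade.TaylorChain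

namespace IntervalD

variable {x : ℝ} {I : IntervalD}

/-! ### Full-precision reciprocal of a positive interval -/

/-- Bit length of a mantissa (`log₂|m| + 1`; `1` for `m = 0`). [folklore] -/
def mbits (m : ℤ) : ℕ := m.natAbs.log2 + 1

/-- **Full-precision reciprocal of a positive interval**: the quotients of `invPos` with numerators `2^(prec + mbits m)`, so that each
endpoint carries at least `prec + 1` significant bits whatever the mantissa length of the argument. [folklore] -/
def invPosN (prec : ℕ) (I : IntervalD) : IntervalD :=
  ⟨(invPos (prec + mbits I.hi.m) I).lo, (invPos (prec + mbits I.lo.m) I).hi⟩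

/-- **Soundness of `invPosN`**: `x ∈ I`, `0 < I.lo` ⇒ `x⁻¹ ∈ invPosN I`. [folklore] -/
theorem mem_invPosN (prec : ℕ) (hlo : 0 < I.lo.toReal) (hx : mem x I) : mem x⁻¹ (invPosN prec I) :=
  ⟨(mem_invPos (prec + mbits I.hi.m) hlo hx).1, (mem_invPos (prec + mbits I.lo.m) hlo hx).2⟩

end IntervalD

namespace CertTables

variable {K : Type} [Field K] {φ : K →+* ℝ} (T : CertTables K)

/-! ### The landing box with the full-precision reciprocal -/

/-- **The landing box (full-precision reciprocal)**: coordinate `c ↦ LvB·[num_c]·[1/|y_{i₀1}|]` with `invPosN`. [folklore] -/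
def landBoxN (prec : ℕ) (LvB : IntervalD) (tv : Dyad) (Y : Array IntervalD) : Array IntervalD :=
  let R := IntervalD.invPosN prec (IntervalD.absBox (IntervalD.aget Y (T.idx T.i₀ 1)))
  Array.ofFn fun c : Fin T.n => IntervalD.mulR prec (IntervalD.mulR prec LvB (T.landNum tv Y c)) R

omit [Field K] in
/-- **Soundness of the landing box (full-precision reciprocal)**: for `y` in the box `Y` (window values), tails `|v i| ≤ tv`, `Lv ∈ LvB`,
and `landOK Y`, every window coordinate of `landF Lv y v` lies in `landBoxN`. [folklore] -/
theorem mem_landF_landBoxN {Y : Array IntervalD} (hok : T.landOK Y = true) (prec : ℕ) {Lv : ℝ} {LvB : IntervalD}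
    (hLv : IntervalD.mem Lv LvB) {tv : Dyad} {v : Fin 4 → ℝ} (hv : ∀ i, |v i| ≤ tv.toReal)
    {y : Fin 4 → ℤ → ℝ} (hy : MemVec T.n (T.wv y) Y) :
    MemVec T.n (T.wv (T.landF Lv y v)) (T.landBoxN prec LvB tv Y) := by
  simp only [landOK, Bool.and_eq_true, decide_eq_true_eq] at hok
  obtain ⟨h1, hsd⟩ := hok
  intro c hc
  have hk := T.InW_wk hc
  -- the reciprocal factor
  have hy0 : IntervalD.mem (y T.i₀ 1) (IntervalD.aget Y (T.idx T.i₀ 1)) := by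
    have := hy (T.idx T.i₀ 1) (T.idx_lt_n T.i₀ h1); rwa [T.wv_idx y T.i₀ h1] at this
  have habs := IntervalD.mem_abs_absBox hsd hy0
  have hR := IntervalD.mem_invPosN prec (IntervalD.absBox_lo_pos hsd) habs
  -- the numerator
  have hnum : IntervalD.mem (if T.wk c + 1 ≤ T.Ka then y (T.wi c) (1 + T.wk c) else v (T.wi c)) (T.landNum tv Y c) := by
    unfold landNum
    by_cases hK : T.wk c + 1 ≤ T.Ka
    · rw [if_pos hK, if_pos hK]
      have hk' : -T.Kb ≤ 1 + T.wk c ∧ 1 + T.wk c ≤ T.Ka := ⟨by linarith [hk.1], by linarith⟩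
      have := hy (T.idx (T.wi c) (1 + T.wk c)) (T.idx_lt_n _ hk')
      rw [T.wv_idx y _ hk', T.idx_one_add _ hk.1, T.idx_wi_wk hc] at this
      exact this
    · rw [if_neg hK, if_neg hK]
      exact IntervalD.mem_symBox (hv _)
  have hprod := IntervalD.mem_mulR prec (IntervalD.mem_mulR prec hLv hnum) hR
  unfold landBoxN
  rw [IntervalD.aget_ofFn _ hc]
  have hval : T.wv (T.landF Lv y v) c = Lv * (if T.wk c + 1 ≤ T.Ka then y (T.wi c) (1 + T.wk c) else v (T.wi c)) * |y T.i₀ 1|⁻¹ := by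
    simp only [wv, landF, div_eq_mul_inv]
  rw [hval]
  exact hprod

/-! ### The landing Jacobian box with the full-precision reciprocal -/

/-- **Interval landing Jacobian (full-precision reciprocal)** `[DL]`: entry `(c, c')` = `LvB·(A ⊖ B)` with
`A := [c' = c+1 ∧ k+1 ≤ Ka]·[1/|y₀|]`, `B := [c' = c₀]·[num_c]·[sign y₀]·[1/|y₀|]²`, reciprocals by `invPosN`. [folklore] -/
def dlBoxN (prec : ℕ) (LvB : IntervalD) (tv : Dyad) (Y : Array IntervalD) : Array (Array IntervalD) :=
  let Y0 := IntervalD.aget Y (T.idx T.i₀ 1)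
  let R := IntervalD.invPosN prec (IntervalD.absBox Y0)
  let R2 := IntervalD.mulR prec R R
  let Sg := IntervalD.signBox Y0
  Array.ofFn fun c : Fin T.n => Array.ofFn fun c' : Fin T.n =>
    IntervalD.mulR prec LvB (IntervalD.subR prec
      (if (c' : ℕ) = c + 1 then (if T.wk c + 1 ≤ T.Ka then R else IntervalD.ofInt 0) else IntervalD.ofInt 0)
      (if (c' : ℕ) = T.idx T.i₀ 1 then IntervalD.mulR prec (IntervalD.mulR prec (T.landNum tv Y c) Sg) R2 else IntervalD.ofInt 0))

omit [Field K] in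
/-- **`dlMat ∈ dlBoxN`** for `y ∈ Y` (window values, `landOK Y`), tails `|v i| ≤ tv`, `Lv ∈ LvB`. [folklore] -/
theorem memMat_dlBoxN {Y : Array IntervalD} (hok : T.landOK Y = true) (prec : ℕ) {Lv : ℝ} {LvB : IntervalD}
    (hLv : IntervalD.mem Lv LvB) {tv : Dyad} {v : Fin 4 → ℝ} (hv : ∀ i, |v i| ≤ tv.toReal)
    {y : Fin 4 → ℤ → ℝ} (hy : MemVec T.n (T.wv y) Y) :
    MemMat T.n (T.dlMat Lv y v) (T.dlBoxN prec LvB tv Y) := by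
  simp only [landOK, Bool.and_eq_true, decide_eq_true_eq] at hok
  obtain ⟨h1, hsd⟩ := hok
  have hy0 : IntervalD.mem (y T.i₀ 1) (IntervalD.aget Y (T.idx T.i₀ 1)) := by
    have := hy (T.idx T.i₀ 1) (T.idx_lt_n T.i₀ h1); rwa [T.wv_idx y T.i₀ h1] at this
  have habs := IntervalD.mem_abs_absBox hsd hy0
  have hR := IntervalD.mem_invPosN prec (IntervalD.absBox_lo_pos hsd) habs
  have hR2 : IntervalD.mem (((y T.i₀ 1) ^ 2)⁻¹)
      (IntervalD.mulR prec (IntervalD.invPosN prec (IntervalD.absBox (IntervalD.aget Y (T.idx T.i₀ 1))))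
        (IntervalD.invPosN prec (IntervalD.absBox (IntervalD.aget Y (T.idx T.i₀ 1))))) := by
    have e : ((y T.i₀ 1) ^ 2)⁻¹ = |y T.i₀ 1|⁻¹ * |y T.i₀ 1|⁻¹ := by rw [← sq_abs, sq, mul_inv]
    rw [e]; exact IntervalD.mem_mulR prec hR hR
  have hSg := IntervalD.mem_sign_signBox hsd hy0
  intro c hc c' hc'
  have hk := T.InW_wk hc
  have hnum : IntervalD.mem (T.numR y v c) (T.landNum tv Y c) := by
    unfold numR landNum
    by_cases hK : T.wk c + 1 ≤ T.Ka
    · rw [if_pos hK, if_pos hK]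
      have hk' : -T.Kb ≤ 1 + T.wk c ∧ 1 + T.wk c ≤ T.Ka := ⟨by linarith [hk.1], by linarith⟩
      have := hy (T.idx (T.wi c) (1 + T.wk c)) (T.idx_lt_n _ hk')
      rw [T.wv_idx y _ hk', T.idx_one_add _ hk.1, T.idx_wi_wk hc] at this
      exact this
    · rw [if_neg hK, if_neg hK]
      exact IntervalD.mem_symBox (hv _)
  unfold dlBoxN
  simp only [imget_ofFn_row _ c' hc, IntervalD.aget_ofFn _ hc']
  refine IntervalD.mem_mulR prec hLv (IntervalD.mem_subR prec ?_ ?_)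
  · unfold dlA
    by_cases he : c' = c + 1
    · simp only [he, if_true]
      by_cases hK : T.wk c + 1 ≤ T.Ka
      · simp only [if_pos hK]; exact hR
      · simp only [if_neg hK]; simpa using IntervalD.mem_ofInt 0
    · simp only [he, if_false]; simpa using IntervalD.mem_ofInt 0
  · unfold dlB
    by_cases he : c' = T.idx T.i₀ 1
    · simp only [he, if_true]
      exact IntervalD.mem_mulR prec (IntervalD.mem_mulR prec hnum hSg) hR2
    · simp only [he, if_false]; simpa using IntervalD.mem_ofInt 0

/-! ### The section projector box with the full-precision reciprocal -/

/-- **Interval section projector (full-precision reciprocal)** `[PS]`: entry `(a,b) = δ_{ab} ⊖ F_a·Wσ_b·[1/gd]`, `gd := dotR Wσ F`,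
reciprocal by `invPosN`. [folklore] -/
def psBoxN (prec : ℕ) (Wσ F : Array IntervalD) : Array (Array IntervalD) :=
  let G := IntervalD.invPosN prec (IntervalD.rangeSumR prec (fun b => IntervalD.mulR prec (IntervalD.aget Wσ b) (IntervalD.aget F b)) T.n)
  Array.ofFn fun a : Fin T.n => Array.ofFn fun b : Fin T.n =>
    IntervalD.subR prec (if (b : ℕ) = a then IntervalD.ofInt 1 else IntervalD.ofInt 0)
      (IntervalD.mulR prec (IntervalD.mulR prec (IntervalD.aget F a) (IntervalD.aget Wσ b)) G)

/-- **`psMat ∈ psBoxN`** when `φ(wσ_b) ∈ Wσ[b]`, `wv q ∈ F`, and `psOK`. [folklore] -/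
theorem memMat_psBoxN (prec : ℕ) {wσ : List K} {Wσ : Array IntervalD}
    (hW : ∀ b < T.n, IntervalD.mem (φ (vget wσ b)) (IntervalD.aget Wσ b)) {q : Fin 4 → ℤ → ℝ} {F : Array IntervalD}
    (hq : MemVec T.n (T.wv q) F) (hok : T.psOK prec Wσ F = true) :
    MemMat T.n (T.psMat φ wσ q) (T.psBoxN prec Wσ F) := by
  have hgd : IntervalD.mem (T.covR φ wσ q)
      (IntervalD.rangeSumR prec (fun b => IntervalD.mulR prec (IntervalD.aget Wσ b) (IntervalD.aget F b)) T.n) := by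
    rw [T.covR_apply φ wσ q]
    exact IntervalD.mem_rangeSumR prec T.n fun b hb => IntervalD.mem_mulR prec (hW b hb) (hq b hb)
  have h0 : 0 < (IntervalD.rangeSumR prec (fun b => IntervalD.mulR prec (IntervalD.aget Wσ b) (IntervalD.aget F b)) T.n).lo.toReal := by
    simpa [psOK, IntervalD.posLo, Dyad.blt_iff] using hok
  have hG := IntervalD.mem_invPosN prec h0 hgd
  intro a ha b hb
  unfold psBoxN
  simp only [imget_ofFn_row _ b ha, IntervalD.aget_ofFn _ hb]
  unfold psMat
  refine IntervalD.mem_subR prec ?_ (IntervalD.mem_mulR prec (IntervalD.mem_mulR prec (hq a ha) (hW b hb)) hG)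
  by_cases he : b = a
  · simp only [he, if_true]; simpa using IntervalD.mem_ofInt 1
  · simp only [he, if_false]; simpa using IntervalD.mem_ofInt 0

/-! ### (R11) with the full-precision kernels -/

/-- **(R11) TEST (full-precision reciprocals)** per face `l < nF` of ball `J`: as `testR11` with `M := [DLN]·[PSN]·[V]`. [folklore] -/
def testR11N (prec nF : ℕ) (W G : Array (Array IntervalD)) (rPB βB : Array IntervalD) (ρ : Array Dyad)
    (LvB : IntervalD) (tv : Dyad) (Y Wσ F : Array IntervalD) (VB : Array (Array IntervalD)) : Bool :=
  let M := mulII T.n prec (mulII T.n prec (T.dlBoxN prec LvB tv Y) (T.psBoxN prec Wσ F)) VB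
  T.landOK Y && T.psOK prec Wσ F &&
  allN nF fun l =>
    let C := IntervalD.covMulIM T.n prec (IntervalD.lget W l) M
    let Gl := IntervalD.lget G l
    Dyad.ble
      (Dyad.add (IntervalD.aget rPB l).hi
        (IntervalD.rangeSumR prec (fun c => IntervalD.mulR prec
          (IntervalD.ofDyad (IntervalD.mag (IntervalD.subR prec (IntervalD.aget C c) (IntervalD.aget Gl c)))) (IntervalD.ofDyad (dget ρ c))) T.n).hi)
      (IntervalD.aget βB l).lo

/-- **Soundness of (R11) (full-precision reciprocals)** in coordinates (hypotheses read exactly as in `testR11_sound`). [folklore] -/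
theorem testR11N_sound {prec nF : ℕ} {W G : Array (Array IntervalD)} {rPB βB : Array IntervalD} {ρ : Array Dyad}
    {LvB : IntervalD} {tv : Dyad} {Y Wσ F : Array IntervalD} {VB : Array (Array IntervalD)}
    (h : T.testR11N prec nF W G rPB βB ρ LvB tv Y Wσ F VB = true)
    {w : ℕ → List K} (hW : ∀ l < nF, ∀ a < T.n, IntervalD.mem (φ (vget (w l) a)) (IntervalD.aget (IntervalD.lget W l) a))
    {g : ℕ → ℕ → ℝ} (hG : ∀ l < nF, ∀ c < T.n, IntervalD.mem (g l c) (IntervalD.aget (IntervalD.lget G l) c))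
    {rP β : ℕ → ℝ} (hrP : ∀ l < nF, IntervalD.mem (rP l) (IntervalD.aget rPB l)) (hβ : ∀ l < nF, IntervalD.mem (β l) (IntervalD.aget βB l))
    {Lv : ℝ} (hLv : IntervalD.mem Lv LvB) {v : Fin 4 → ℝ} (hv : ∀ i, |v i| ≤ tv.toReal)
    {y : Fin 4 → ℤ → ℝ} (hy : MemVec T.n (T.wv y) Y)
    {wσ : List K} (hWσ : ∀ b < T.n, IntervalD.mem (φ (vget wσ b)) (IntervalD.aget Wσ b))
    {q : Fin 4 → ℤ → ℝ} (hq : MemVec T.n (T.wv q) F)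
    {vm : ℕ → ℕ → ℝ} (hV : MemMat T.n vm VB)
    {ζ : ℕ → ℝ} (hρ : ∀ c < T.n, |ζ c| ≤ (dget ρ c).toReal)
    (hface : ∀ l < nF, |∑ c ∈ Finset.range T.n, g l c * ζ c| ≤ rP l)
    {z : Fin 4 → ℤ → ℝ} (hz : ∀ b < T.n, T.wv z b = ∑ c ∈ Finset.range T.n, vm b c * ζ c)
    {l : ℕ} (hl : l < nF) :
    |∑ a ∈ Finset.range T.n, φ (vget (w l) a) * T.wv (T.landDF Lv y v (T.secCorrF φ wσ q z)) a| ≤ β l := by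
  unfold testR11N at h
  simp only [Bool.and_eq_true] at h
  obtain ⟨⟨hok, hps⟩, hall⟩ := h
  have h1 : -T.Kb ≤ 1 ∧ (1 : ℤ) ≤ T.Ka := by
    have := hok; simp only [landOK, Bool.and_eq_true, decide_eq_true_eq] at this; exact this.1
  have hb := (allN_eq_true.1 hall) l hl
  simp only [Dyad.ble_iff, Dyad.toReal_add] at hb
  -- the real matrices
  have hDL := T.memMat_dlBoxN hok prec hLv hv hy
  have hPS := T.memMat_psBoxN prec hWσ hq hps
  have hM := memMat_mulII prec (memMat_mulII prec hDL hPS) hV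
  -- the identity: the read-out derivative is ⟨row, ζ⟩
  have hcoord : ∀ a < T.n, T.wv (T.landDF Lv y v (T.secCorrF φ wσ q z)) a
      = ∑ c ∈ Finset.range T.n,
          (∑ b' ∈ Finset.range T.n, (∑ b ∈ Finset.range T.n, T.dlMat Lv y v a b * T.psMat φ wσ q b b') * vm b' c) * ζ c := by
    intro a ha
    rw [T.wv_landDF h1 Lv y v _ ha]
    have : ∑ c' ∈ Finset.range T.n, T.dlMat Lv y v a c' * T.wv (T.secCorrF φ wσ q z) c'
        = ∑ b ∈ Finset.range T.n, T.dlMat Lv y v a b * ∑ b' ∈ Finset.range T.n, T.psMat φ wσ q b b' * ∑ c ∈ Finset.range T.n, vm b' c * ζ c := by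
      refine Finset.sum_congr rfl fun b hb' => ?_
      rw [T.wv_secCorrF wσ q z (Finset.mem_range.1 hb')]
      congr 1
      exact Finset.sum_congr rfl fun b' hb'' => by rw [hz b' (Finset.mem_range.1 hb'')]
    rw [this, triple_eq_row]
  have hrow : ∑ a ∈ Finset.range T.n, φ (vget (w l) a) * T.wv (T.landDF Lv y v (T.secCorrF φ wσ q z)) a
      = ∑ c ∈ Finset.range T.n, (∑ a ∈ Finset.range T.n, φ (vget (w l) a) *
          (∑ b' ∈ Finset.range T.n, (∑ b ∈ Finset.range T.n, T.dlMat Lv y v a b * T.psMat φ wσ q b b') * vm b' c)) * ζ c := by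
    rw [← bilin_eq_row]
    exact Finset.sum_congr rfl fun a ha => by rw [hcoord a (Finset.mem_range.1 ha)]
  rw [hrow]
  have hC := fun c (hc : c < T.n) => IntervalD.mem_covMulIM prec (hW l hl) hM hc
  have hbound := abs_row_le prec hC (hG l hl) hρ (hface l hl)
  exact le_trans hbound (le_trans (by linarith [(hrP l hl).2]) (le_trans hb (hβ l hl).1))

end CertTables

end Summit.NavierStokesRegularity.NavierStokesRegularity.Theorems.TaylorModelCert
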